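import Mathlib
import Literature.NumberTheory.Transcendental.ZagierDilogarithmConjecture
import Literature.NumberTheory.Transcendental.BlochWignerDilogarithm
import Literature.NumberTheory.Transcendental.BlochWignerDilogarithmProofs
import Summits.KontsevichZagierPeriods.KontsevichZagierPeriods.Theorems.HyperbolicBlochZagierDilogarithmConjectureStubCyclotomicTwists
import Summits.KontsevichZagierPeriods.KontsevichZagierPeriods.Theorems.HyperbolicBlochZagierDilogarithmConjectureStubCyclotomicTorsionDescent
import Summits.KontsevichZagierPeriods.KontsevichZagierPeriods.Theorems.HyperbolicBlochZagierDilogarithmConjectureStubCyclotomicFolding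
import Summits.KontsevichZagierPeriods.KontsevichZagierPeriods.Theorems.HyperbolicBlochZagierDilogarithmConjectureStubCyclotomicSpanning
import Summits.KontsevichZagierPeriods.KontsevichZagierPeriods.Theorems.HyperbolicBlochZagierDilogarithmConjectureStubEqZeroOfTwists
import HarnessLib

/-!
# `ZagierDilogarithmConjecture` (stmt-KontsevichZagierPeriods-10550) — line `kummer-clausen-linearisation`
(reshape c5, "the cyclotomic tower and the abelian sector"), stub `stub_cyclotomicDescent_iff`

**Galois descent on the roots of unity without Borel, iff form (UNCONDITIONAL).** Let `ζ_N = exp(2πi/N)`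
(`N ≥ 1`), `D = blochWignerDilog` the Bloch–Wigner dilogarithm and `C = ⟨dilogRelators⟩ ⊆ ℤ[ℂ]` the
relator group of Zagier's conjecture. For `x = Σ_{c mod N} m_c [ζ_N^c] ∈ ℤ[μ_N]`:

  some positive multiple `M • x` lies in `C`  ⇔  all Galois-twisted volumes
  `Σ_c m_c D(ζ_N^{ac})` (`a ∈ (ℤ/N)ˣ`) vanish.

So on `μ_N` the Galois descent of the line needs neither Borel's theorem nor Dupont's: the relator group
already sees every embedding.

Proof.
* (⇒) `M • x = Σ_c (M m_c) [ζ_N^c] ∈ C`, so by the in-tree stub `stub_cyclotomicTwists` (field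
  automorphisms `ζ_N ↦ ζ_N^a` preserve `C`, and `D` kills `C`) every twisted volume of `M • x` vanishes:
  `M · Σ_c m_c D(ζ_N^{ac}) = 0`, and `M ≠ 0`.
* (⇐) the in-tree torsion descent `stub_cyclotomicTorsionDescent`, whose two hypotheses are the in-tree
  folding `stub_cyclotomicFolding stub_cyclotomicSpanning` (every `x` has a positive multiple congruent
  mod `C` to a combination supported on the units of the open upper half) and the in-tree
  `stub_eqZeroOfTwists` (such a combination with all twisted volumes zero is zero).

Sorry-free; axioms ⊆ {propext, Classical.choice, Quot.sound}.

## References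

* W. D. Neumann, *Hilbert's 3rd problem and invariants of 3-manifolds*, Geom. Topol. Monogr. 1
  (1998), §2.1 (the relator group, Galois action on the Bloch group). [Neumann1998]
* D. Zagier, *The dilogarithm function*, in: Frontiers in Number Theory, Physics, and Geometry II
  (2007), Ch. I §§3–4. [Zagier2007Dilogarithm]
-/

noncomputable section

open scoped BigOperators ComplexConjugate
open Literature.NumberTheory.Transcendental

namespace Summit.KontsevichZagierPeriods.HyperbolicBloch.ZagierDilogarithmCyclotomic

/-! ### Two bookkeeping identities -/

/-- `M • Σ_c m_c • F c = Σ_c (M m_c) • F c` in an additive commutative group (`M : ℕ`, `m_c : ℤ`).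
[folklore] -/
theorem nsmul_sum_zsmul_eq_sum_mul_zsmul {ι A : Type*} [Fintype ι] [AddCommGroup A] (M : ℕ)
    (m : ι → ℤ) (F : ι → A) :
    M • ∑ c, m c • F c = ∑ c, ((M : ℤ) * m c) • F c := by
  rw [← natCast_zsmul, Finset.smul_sum]
  exact Finset.sum_congr rfl fun c _ => by rw [mul_smul]

/-- `Σ_c (M m_c) · v c = M · Σ_c m_c · v c` over `ℝ` (casts from `ℕ` and `ℤ`). [folklore] -/
theorem sum_cast_natMul_mul {ι : Type*} [Fintype ι] (M : ℕ) (m : ι → ℤ) (v : ι → ℝ) :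
    ∑ c, (((M : ℤ) * m c : ℤ) : ℝ) * v c = (M : ℝ) * ∑ c, (m c : ℝ) * v c := by
  rw [Finset.mul_sum]
  exact Finset.sum_congr rfl fun c _ => by push_cast; ring

/-! ### The stub -/

/-- **Stub `stub_cyclotomicDescent_iff` (Galois descent on the roots of unity WITHOUT Borel, iff form,
unconditional).** For `x = Σ_c m_c[ζ_N^c] ∈ ℤ[μ_N]`: a positive multiple of `x` lies in
`⟨dilogRelators⟩` iff all its Galois-twisted volumes `Σ_c m_c D(ζ_N^{ac})` (`a` a unit) vanish.
(`⇒`) `stub_cyclotomicTwists` applied to `M • x = Σ_c (M m_c)[ζ_N^c]` and `M ≠ 0`; (`⇐`)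
`stub_cyclotomicTorsionDescent` with its folding hypothesis discharged by
`stub_cyclotomicFolding stub_cyclotomicSpanning` and its rigidity hypothesis by `stub_eqZeroOfTwists`.
[cite: Neumann1998, §2.1] -/
theorem stub_cyclotomicDescent_iff :
    ∀ (N : ℕ) [NeZero N] (m : ZMod N → ℤ),
      (∃ M : ℕ, 0 < M ∧
          M • ∑ c : ZMod N, m c • FreeAbelianGroup.of (Complex.exp (2 * Real.pi * Complex.I / N) ^ c.val) ∈
            AddSubgroup.closure dilogRelators) ↔
        ∀ a : (ZMod N)ˣ, ∑ c : ZMod N, (m c : ℝ) *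
          blochWignerDilog (Complex.exp (2 * Real.pi * Complex.I / N) ^ ((a : ZMod N) * c).val) = 0 := by
  intro N _ m
  constructor
  · -- (⇒): the twisted volumes of `M • x = Σ_c (M m_c) [ζ^c] ∈ C` vanish, and `M ≠ 0`
    rintro ⟨M, hM, hmem⟩ a
    have hT := stub_cyclotomicTwists N (fun c => (M : ℤ) * m c)
      (by rw [← nsmul_sum_zsmul_eq_sum_mul_zsmul]; exact hmem) a
    rw [sum_cast_natMul_mul] at hT
    exact (mul_eq_zero.mp hT).resolve_left (Nat.cast_ne_zero.mpr hM.ne')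
  · -- (⇐): torsion descent, with folding (from spanning) and rigidity discharged in-tree
    intro htw
    exact stub_cyclotomicTorsionDescent (stub_cyclotomicFolding stub_cyclotomicSpanning)
      stub_eqZeroOfTwists N m htw

end Summit.KontsevichZagierPeriods.HyperbolicBloch.ZagierDilogarithmCyclotomic

end
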